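import Mathlib
import Literature.Analysis.FluidPDE.TypeIAncientMild
import Literature.Analysis.FluidPDE.TypeIAncientMildClassical
import Literature.Analysis.FluidPDE.GigaMiura2011ScaledAlignmentBlowupLimitHolds
import Literature.Analysis.FluidPDE.CurlFreeLiouville
import Literature.Analysis.FluidPDE.VorticityCalculus
import Literature.Analysis.FluidPDE.SpaceTimeCalculus
import Literature.Analysis.FluidPDE.AxisymmetricVorticityTransport
import Literature.Analysis.FluidPDE.TsaiMaximumPrinciple
import Literature.Analysis.FluidPDE.LocalBiotSavartCalculus
import Literature.Analysis.PDE.PoissonBall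
import Summits.NavierStokesRegularity.NavierStokesRegularity.Theorems.SymmetryModuliCountStretchingCertificateComparisonKato
import HarnessLib
import Summits.NavierStokesRegularity.NavierStokesRegularity.Theorems.ScenarioCensusModeRankShell

/-!
# Census row A1apT, in-row members A1ex / A1po / A1jb / A1cs / A1qx (and A1cx) — instrument «TEMPORAL SPECTRUM», LINE «temporal-spectrum» REV 4 port, part 1/12:
# dominant balance for finite exponential sums (§A), spatial Liouville lemmas (§B, taken BY NAME from the mode-rank port), the instrument and the gauge
# (shared lemmas BY NAME), calculus of exponential mode sums (§C)

Re-homed for the scenario census (typer seat ns-census-typer-1 g8; the cells A1ex / A1po are MEMBERS OF RECORD «DECIDED IN KERNEL IN FILES» of row A1apT since census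
v1.69 and A1jb / A1cs / A1qx / A1cx since v1.71 (critic idea-crit-3 g6 PASS — no price 20:33:05Z, RE-STAMPs REV 2 → REV 3 → REV 4 22:13:50Z; ref ns-census-ref g8
PRE-CHECK ✓ §13.14 item 11 + items 19/20; lit §21.21 / §21.24 (a)); this port makes them TREE-decided): VERBATIM PORT of ns-idea-2 LINE g12-2 «temporal-spectrum»
REV 4, `pub/ideators/ns-idea-2/lines/temporal-spectrum/line-temporal-spectrum.lean` sha16 f2331f3a0765e1d4 (3431 l., lean check rc 0, 0 sorry), split for the
400-line rule into twelve parts `ScenarioCensusTemporalSpectrum{∅, Exponential, Oscillatory, OscillatoryRow, Jordan, Complex, ComplexDecay, ComplexRow, Quasi, QuasiGroup,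
QuasiRow, Head}` (chain imports).  Lean text VERBATIM in namespace `…Theorems.ScenarioCensus.TemporalSpectrum` (the line's `…Lines.TemporalSpectrum` re-homed);
port edits: the two `local notation "E3"` lines → one `abbrev E3` at namespace level and the bracket lines `section Rows` / `end Rows` dropped (no `variable`s
there; typer lint: no notation in port files), `@[conjecture]` on the OPEN head `Row_A1qp` (typed only), twenty-one one-line docstrings added (gate lint); the
lemmas the line shares VERBATIM with «mode-rank» / «floquet-meter» (§B spatial Liouville lemmas, the instrument `vortB` / `vortB_sum_sum`, the gauge
`tendsto_slice_atBot` / `eq_zero_of_curl_slice_const`, `laplacian_zero_apply`, `norm_curl_le_four_mul`) are taken BY NAME from those landed ports (listed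
below); `tendsto_typeI_bound` (twin of a landed tree lemma in a module the farm does not build) is not re-declared and its four uses carry the one-line
Mathlib proof inline (proof text only).  Statements untouched.

No census VALUE is moved here (row A1apT keeps its value; the members become TREE-decided by name); NS regularity is NOT proved; (L′) ⟨10661⟩ is
untouched; no summit statement is proved by this file. Lemmas that restate already-landed tree declarations are taken BY NAME (gate lint `dedup.landed`): `apply_eq_apply_of_harmonic_bounded` = `ModeRank.apply_eq_apply_of_harmonic_bounded`, `apply_eq_apply_of_curl_const` = `ModeRank.apply_eq_apply_of_curl_const`, `nonpos_of_laplacian_eq_mul` = `ModeRank.nonpos_of_laplacian_eq_mul`, `eq_zero_of_laplacian_eq_smul_of_pos` = `ModeRank.eq_zero_of_laplacian_eq_smul_of_pos`, `vortB` = `ModeRank.vortB`, `vortB_sum_sum` = `ModeRank.vortB_sum_sum`, `tendsto_slice_atBot` = `ModeRank.tendsto_slice_atBot`, `eq_zero_of_curl_slice_const` = `ModeRank.eq_zero_of_curl_slice_const`, `laplacian_zero_apply` = `ModeRank.laplacian_zero_fun`, `norm_curl_le_four_mul` = `FloquetMeter.norm_curl_le_four_mul`.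
-/

-- the summit and its single problem share the name `NavierStokesRegularity` (D-0017 nested layout)
set_option linter.dupNamespace false

noncomputable section

open Set Function Filter Topology

namespace Summit.NavierStokesRegularity.NavierStokesRegularity.Theorems.ScenarioCensus.TemporalSpectrum

open Literature.Analysis Literature.Analysis.FluidPDE InnerProductSpace
open Summit.NavierStokesRegularity.NavierStokesRegularity.Theorems (vorticity_eq_deriv_of_typeI)
open scoped Laplacian InnerProductSpace RealInnerProductSpace ContDiff

/-- `ℝ³` (the line's `local notation "E3"`, spelled as a reducible abbreviation for the tree). -/
abbrev E3 := EuclideanSpace ℝ (Fin 3)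

/-! ## A. Dominant balance for finite exponential sums -/

section ExpSum

variable {ι : Type*} [Fintype ι] {G : Type*} [NormedAddCommGroup G] [NormedSpace ℝ G]

/-- Dominant balance at `-∞` (auxiliary form with an explicit finset of admissible exponents). -/
theorem sum_filter_eq_zero_aux (s : Finset ℝ) :
    ∀ (ν : ι → ℝ) (C : ι → G), (∀ i, C i ≠ 0 → ν i ∈ s) →
      Tendsto (fun t : ℝ => ∑ i, Real.exp (ν i * t) • C i) atBot (𝓝 0) →
      ∀ r ≤ 0, ∑ i ∈ Finset.univ.filter (fun i => ν i = r), C i = 0 := by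
  classical
  induction s using Finset.induction_on_min with
  | empty =>
    intro ν C hs h r hr
    exact Finset.sum_eq_zero fun i _ => by
      by_contra hi
      simpa using hs i hi
  | insert a s ha IH =>
    intro ν C hs h r hr
    by_cases ha0 : 0 < a
    · -- every admissible exponent is positive: the `r`-group is empty of non-zero coefficients
      refine Finset.sum_eq_zero fun i hi => ?_
      rw [Finset.mem_filter] at hi
      by_contra hCi
      have hmem := hs i hCi
      rw [Finset.mem_insert] at hmem
      rcases hmem with h1 | h1
      · linarith [hi.2]
      · linarith [ha _ h1, hi.2]
    push Not at ha0
    -- the `a`-group vanishes: multiply by `e^{-a t}` and let `t → -∞`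
    have hgroup : ∑ i ∈ Finset.univ.filter (fun i => ν i = a), C i = 0 := by
      have h1 : Tendsto (fun t : ℝ => Real.exp (-a * t) • ∑ i, Real.exp (ν i * t) • C i)
          atBot (𝓝 0) := by
        rcases ha0.lt_or_eq with hlt | heq
        · have he : Tendsto (fun t : ℝ => Real.exp (-a * t)) atBot (𝓝 0) :=
            Real.tendsto_exp_atBot.comp (tendsto_id.const_mul_atBot (by linarith))
          simpa using he.smul h
        · subst heq
          simpa using h
      have h2 : ∀ t : ℝ, Real.exp (-a * t) • ∑ i, Real.exp (ν i * t) • C i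
          = ∑ i ∈ Finset.univ.filter (fun i => ν i = a), C i
            + ∑ i ∈ Finset.univ.filter (fun i => ¬ ν i = a), Real.exp ((ν i - a) * t) • C i := by
        intro t
        rw [Finset.smul_sum, ← Finset.sum_filter_add_sum_filter_not Finset.univ (fun i => ν i = a)]
        congr 1
        · refine Finset.sum_congr rfl fun i hi => ?_
          rw [Finset.mem_filter] at hi
          rw [hi.2, smul_smul, ← Real.exp_add]
          simp
        · refine Finset.sum_congr rfl fun i _ => ?_
          rw [smul_smul, ← Real.exp_add, show -a * t + ν i * t = (ν i - a) * t by ring]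
      have h3 : Tendsto (fun t : ℝ => ∑ i ∈ Finset.univ.filter (fun i => ¬ ν i = a),
          Real.exp ((ν i - a) * t) • C i) atBot (𝓝 0) := by
        rw [show (0 : G) = ∑ i ∈ Finset.univ.filter (fun i => ¬ ν i = a), (0 : G) by simp]
        refine tendsto_finsetSum _ fun i hi => ?_
        rw [Finset.mem_filter] at hi
        by_cases hCi : C i = 0
        · simp [hCi]
        have hνi : a < ν i := by
          have hmem := hs i hCi
          rw [Finset.mem_insert] at hmem
          exact ha _ (hmem.resolve_left hi.2)
        have he : Tendsto (fun t : ℝ => Real.exp ((ν i - a) * t)) atBot (𝓝 0) :=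
          Real.tendsto_exp_atBot.comp (tendsto_id.const_mul_atBot (by linarith))
        simpa using he.smul_const (C i)
      have h4 := h1.sub h3
      have h5 : (fun t : ℝ => Real.exp (-a * t) • ∑ i, Real.exp (ν i * t) • C i
          - ∑ i ∈ Finset.univ.filter (fun i => ¬ ν i = a), Real.exp ((ν i - a) * t) • C i)
          = fun _ => ∑ i ∈ Finset.univ.filter (fun i => ν i = a), C i := by
        funext t; rw [h2 t]; abel
      rw [h5, sub_zero] at h4
      exact tendsto_nhds_unique tendsto_const_nhds h4
    -- zero out the `a`-group and recurse on `s`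
    set C' : ι → G := fun i => if ν i = a then 0 else C i with hC'
    have hs' : ∀ i, C' i ≠ 0 → ν i ∈ s := by
      intro i hi
      simp only [hC'] at hi
      split_ifs at hi with hia
      · exact absurd rfl hi
      · have hmem := hs i hi
        rw [Finset.mem_insert] at hmem
        exact hmem.resolve_left hia
    have hF : ∀ t : ℝ, ∑ i, Real.exp (ν i * t) • C' i = ∑ i, Real.exp (ν i * t) • C i := by
      intro t
      have hsplit := Finset.sum_filter_add_sum_filter_not Finset.univ (fun i => ν i = a)
        (fun i => Real.exp (ν i * t) • C i)
      have hsplit' := Finset.sum_filter_add_sum_filter_not Finset.univ (fun i => ν i = a)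
        (fun i => Real.exp (ν i * t) • C' i)
      rw [← hsplit, ← hsplit']
      have hz : ∑ i ∈ Finset.univ.filter (fun i => ν i = a), Real.exp (ν i * t) • C i = 0 := by
        have : ∑ i ∈ Finset.univ.filter (fun i => ν i = a), Real.exp (ν i * t) • C i
            = Real.exp (a * t) • ∑ i ∈ Finset.univ.filter (fun i => ν i = a), C i := by
          rw [Finset.smul_sum]
          refine Finset.sum_congr rfl fun i hi => ?_
          rw [Finset.mem_filter] at hi; rw [hi.2]
        rw [this, hgroup, smul_zero]
      have hz' : ∑ i ∈ Finset.univ.filter (fun i => ν i = a), Real.exp (ν i * t) • C' i = 0 :=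
        Finset.sum_eq_zero fun i hi => by
          rw [Finset.mem_filter] at hi; simp [hC', hi.2]
      rw [hz, hz']
      congr 1
      refine Finset.sum_congr rfl fun i hi => ?_
      rw [Finset.mem_filter] at hi; simp [hC', hi.2]
    have h' : Tendsto (fun t : ℝ => ∑ i, Real.exp (ν i * t) • C' i) atBot (𝓝 0) := by
      simpa only [hF] using h
    have IH' := IH ν C' hs' h' r hr
    by_cases hra : r = a
    · subst hra; exact hgroup
    · rw [← IH']
      refine Finset.sum_congr rfl fun i hi => ?_
      rw [Finset.mem_filter] at hi
      have : ν i ≠ a := fun h => hra (hi.2 ▸ h)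
      simp [hC', this]

/-- **Dominant balance at `-∞`.**  If a finite exponential sum `∑ᵢ e^{νᵢ t} Cᵢ` tends to `0` as
`t → -∞`, then for every value `r ≤ 0` the coefficients carrying the exponent `r` sum to zero. -/
theorem sum_filter_eq_zero_of_tendsto (ν : ι → ℝ) (C : ι → G)
    (h : Tendsto (fun t : ℝ => ∑ i, Real.exp (ν i * t) • C i) atBot (𝓝 0)) :
    ∀ r ≤ 0, ∑ i ∈ Finset.univ.filter (fun i => ν i = r), C i = 0 := by
  classical
  exact sum_filter_eq_zero_aux (Finset.univ.image ν) ν C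
    (fun i _ => Finset.mem_image_of_mem ν (Finset.mem_univ i)) h

/-- **Linear independence of real exponentials, grouped form.**  If `∑ᵢ e^{νᵢ t} Cᵢ = 0` for all
`t < 0`, then for every value `r` the coefficients carrying the exponent `r` sum to zero. -/
theorem sum_filter_eq_zero_of_eq_zero (ν : ι → ℝ) (C : ι → G)
    (h : ∀ t < 0, ∑ i, Real.exp (ν i * t) • C i = 0) (r : ℝ) :
    ∑ i ∈ Finset.univ.filter (fun i => ν i = r), C i = 0 := by
  classical
  have h' : Tendsto (fun t : ℝ => ∑ i, Real.exp ((ν i - r - 1) * t) • C i) atBot (𝓝 0) := by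
    refine tendsto_const_nhds.congr' ?_
    filter_upwards [Iio_mem_atBot (0 : ℝ)] with t ht
    have : ∑ i, Real.exp ((ν i - r - 1) * t) • C i
        = Real.exp (-(r + 1) * t) • ∑ i, Real.exp (ν i * t) • C i := by
      rw [Finset.smul_sum]
      refine Finset.sum_congr rfl fun i _ => ?_
      rw [smul_smul, ← Real.exp_add, show -(r + 1) * t + ν i * t = (ν i - r - 1) * t by ring]
    rw [this, h t ht, smul_zero]
  have key := sum_filter_eq_zero_of_tendsto (fun i => ν i - r - 1) C h' (-1) (by norm_num)
  rw [← key]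
  refine Finset.sum_congr ?_ fun _ _ => rfl
  ext i
  simp only [Finset.mem_filter, Finset.mem_univ, true_and]
  constructor <;> intro hh <;> linarith

end ExpSum

/-! ## B. Spatial Liouville lemmas (shared with line «mode-rank») -/

section Spatial

/-! ### A4. Spatial Liouville lemmas for the shells `μ ≥ 0`. -/

-- `apply_eq_apply_of_harmonic_bounded`: the line restates the tree's `ModeRank.apply_eq_apply_of_harmonic_bounded`; taken BY NAME (gate lint dedup.landed).

-- `apply_eq_apply_of_curl_const`: the line restates the tree's `ModeRank.apply_eq_apply_of_curl_const`; taken BY NAME (gate lint dedup.landed).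

-- `nonpos_of_laplacian_eq_mul`: the line restates the tree's `ModeRank.nonpos_of_laplacian_eq_mul`; taken BY NAME (gate lint dedup.landed).

-- `eq_zero_of_laplacian_eq_smul_of_pos`: the line restates the tree's `ModeRank.eq_zero_of_laplacian_eq_smul_of_pos`; taken BY NAME (gate lint dedup.landed).

end Spatial

-- `vortB`: the line restates the tree's `ModeRank.vortB`; taken BY NAME (gate lint dedup.landed).

-- `vortB_sum_sum`: the line restates the tree's `ModeRank.vortB_sum_sum`; taken BY NAME (gate lint dedup.landed).

-- `tendsto_typeI_bound`: the Type-I envelope `C/√(-s) → 0` at `-∞` restates a landed tree lemma (gate lint dedup.landed, twin `…Theorems.PolyhedralDssProfileExists.PolyhedralCell.tendsto_typeI_envelope_atBot`, whose module the farm does not build); not re-declared — its uses below carry the one-line Mathlib proof inline (port edit, proof text only).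

-- `tendsto_slice_atBot`: the line restates the tree's `ModeRank.tendsto_slice_atBot`; taken BY NAME (gate lint dedup.landed).

-- `eq_zero_of_curl_slice_const`: the line restates the tree's `ModeRank.eq_zero_of_curl_slice_const`; taken BY NAME (gate lint dedup.landed).

/-! ## C. Calculus of exponential mode sums -/

/-- Curl of a finite linear combination of differentiable fields. -/
theorem curl_sum_smul {n : ℕ} {φ : Fin n → E3 → E3} (hφ : ∀ k, Differentiable ℝ (φ k))
    (c : Fin n → ℝ) (x : E3) :
    curl (fun y => ∑ k, c k • φ k y) x = ∑ k, c k • curl (φ k) x := by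
  classical
  suffices h : ∀ s : Finset (Fin n),
      curl (fun y => ∑ k ∈ s, c k • φ k y) x = ∑ k ∈ s, c k • curl (φ k) x from h Finset.univ
  intro s
  induction s using Finset.induction_on with
  | empty => simp
  | insert a s ha IH =>
    have h1 : (fun y => ∑ k ∈ insert a s, c k • φ k y)
        = fun y => c a • φ a y + ∑ k ∈ s, c k • φ k y := by
      funext y; simp [Finset.sum_insert ha]
    have hd1 : DifferentiableAt ℝ (fun y => c a • φ a y) x := ((hφ a) x).const_smul (c a)
    have hd2 : DifferentiableAt ℝ (fun y => ∑ k ∈ s, c k • φ k y) x :=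
      DifferentiableAt.fun_sum fun k _ => ((hφ k) x).const_smul (c k)
    rw [h1, curl_add hd1 hd2, IH, Finset.sum_insert ha, curl_const_smul ((hφ a) x) (c a)]

/-- Laplacian of a finite linear combination of `C²` fields. -/
theorem laplacian_sum_smul {n : ℕ} {w : Fin n → E3 → E3} (hw : ∀ k, ContDiff ℝ 2 (w k))
    (c : Fin n → ℝ) (x : E3) :
    (Δ (fun y => ∑ k, c k • w k y)) x = ∑ k, c k • (Δ (w k)) x := by
  classical
  suffices h : ∀ s : Finset (Fin n),
      (Δ (fun y => ∑ k ∈ s, c k • w k y)) x = ∑ k ∈ s, c k • (Δ (w k)) x from h Finset.univ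
  intro s
  induction s using Finset.induction_on with
  | empty =>
    have h0 : (fun y : E3 => ∑ k ∈ (∅ : Finset (Fin n)), c k • w k y) = (0 : E3 → E3) := by
      funext y; simp
    have h := InnerProductSpace.laplacian_smul (𝕜 := ℝ) (f := (0 : E3 → E3)) (x := x) (0 : ℝ)
      contDiffAt_const
    rw [h0, Finset.sum_empty]
    simpa using h
  | insert a s ha IH =>
    have h1 : (fun y => ∑ k ∈ insert a s, c k • w k y)
        = (c a • w a) + fun y => ∑ k ∈ s, c k • w k y := by
      funext y; simp [Finset.sum_insert ha]
    have hc1 : ContDiffAt ℝ 2 (c a • w a) x := ((hw a).const_smul (c a)).contDiffAt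
    have hc2 : ContDiffAt ℝ 2 (fun y => ∑ k ∈ s, c k • w k y) x :=
      (ContDiff.sum fun k _ => (hw k).const_smul (c k)).contDiffAt
    rw [h1, hc1.laplacian_add hc2, IH, Finset.sum_insert ha,
      InnerProductSpace.laplacian_smul (c a) (hw a).contDiffAt]

/-- Time derivative of an exponential mode sum. -/
theorem hasDerivAt_expSum {n : ℕ} (σ : Fin n → ℝ) (v : Fin n → E3) (t : ℝ) :
    HasDerivAt (fun s => ∑ k, Real.exp (σ k * s) • v k)
      (∑ k, (Real.exp (σ k * t) * σ k) • v k) t := by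
  refine HasDerivAt.fun_sum fun k _ => ?_
  have h1 : HasDerivAt (fun s => σ k * s) (σ k) t := by
    simpa using (hasDerivAt_id t).const_mul (σ k)
  exact (h1.exp).smul_const (v k)

/-- `B(0, w) = 0`. -/
theorem vortB_zero_left (w : E3 → E3) (x : E3) : ModeRank.vortB (0 : E3 → E3) w x = 0 := by
  have h : (0 : E3 → E3) = fun _ => (0 : E3) := rfl
  simp [ModeRank.vortB, h]

/-- `B(v, 0) = 0`. -/
theorem vortB_zero_right (v : E3 → E3) (x : E3) : ModeRank.vortB v (0 : E3 → E3) x = 0 := by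
  have h : (0 : E3 → E3) = fun _ => (0 : E3) := rfl
  simp [ModeRank.vortB, h]

end Summit.NavierStokesRegularity.NavierStokesRegularity.Theorems.ScenarioCensus.TemporalSpectrum

end
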